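import Summits.NavierStokesRegularity.NavierStokesRegularity.Theses.PalasekTowerBreakdown
import Summits.NavierStokesRegularity.FluidComputer.PalasekTowerOvershootFirstHitting
import Summits.NavierStokesRegularity.FluidComputer.PalasekTowerRegisterGlobalKatoWindow
import Summits.NavierStokesRegularity.FluidComputer.PalasekTowerRegisterGlobalStrainCeiling

/-!
# NavierStokesRegularity — route `PalasekTowerBreakdown`: the UPPER stub of the child crux
# `HeredityFromTwo` as ONE located event — `AprioriCeiling` ⟺ «no LATE, STRAIN-CAPPED,
# pressure-driven FIRST OVERSHOOT of a level in `(c₂Y_{k+1}, 2c₂Y_{k+1}]`» (lossless)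

Supports `stmt-NavierStokesRegularity-19250` (`PalasekTowerBreakdown.HeredityFromTwo := HeredityFrom 2`;
registered skeleton v2 `Cruxes/HeredityFromTwo/Lines/birth.lean` f6df89a9b00ae750 of seat
`ns-palasek-19250-p1`: stubs `stub_apriori_ceiling : AprioriCeiling` / `stub_readout_floors :
ReadoutFloors`). Cell `ns-blowup`, seat `ns-palasek-19250-p2` (g0; STUB-WORKER on the upper stub —
nothing claimed; the lead of record keeps the line). LABEL: E–C typing + kernel analysis (every
statement PROVED from landed register theorems; no `Prop` introduced; no named fact). WHAT THIS IS
NOT: not NS — no stage, flow or tower is constructed; the upper stub is neither proved nor refuted;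
the theorems say EXACTLY what a counterexample to it must exhibit, and conversely.

## What is proved

The tree knows three things about the continuations `(u, p)` quantified in `AprioriCeiling` (every
finite-energy classical continuation on `[0, T'] ⊆ [0, τ_{k+1}]` of a registered stage at `k ≥ 2` of a
pinned rigid quiet wide schedule, unit viscosity): (i) the Kato/Leray START of the window is
overshoot-free (`exists_norm_le_ceiling_of_kato_window`, p429305: `‖u‖ ≤ c₂Y_{k+1}` while
`t − τ_k < c₀/(c₂Y_k)²`); (ii) a level `L > c₂Y_k` that is reached is FIRST reached after `τ_k` at a
global argmax, non-decreasing in time there, PRESSURE-DRIVEN: `|Du|²_F + ⟪u, ∇p⟫ ≤ 0`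
(`Stage.exists_firstOvershoot`, p441906/p442281), with `⟪u, Du·v⟫ = 0`
(`HittingCalculus.inner_fderiv_eq_zero_of_isMax`); (iii) the STRAIN CEILING of the silent window
(`Stage.exists_strainCeiling_continuation`, p449…: `‖∇u‖ ≤ C·M²` wherever `‖u‖ ≤ M` held since `τ_k`
for a time `≥ ε/M²`). This file FOLDS (i)–(iii) into the upper stub, losslessly:

* `palasekTowerBreakdown_exists_aprioriCeiling_iff_noCappedFirstOvershoot` — there are UNIVERSAL
  `c₀ > 0`, `C ≥ 0` such that `AprioriCeiling` holds IF AND ONLY IF no continuation as above admits a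
  level `L ∈ (c₂Y_{k+1}, 2c₂Y_{k+1}]`, a time `t₀ ∈ (τ_k, T']` with `t₀ ≥ τ_k + c₀/(c₂Y_k)²` (LATE) and
  a point `x₀` with: `‖u(t₀, x₀)‖ = L` is a global spatial maximum, `‖u‖ < L` everywhere on
  `[0, t₀)` (FIRST overshoot), `0 ≤ ⟪u, ∂ₜu⟫`, `|Du|²_F + ⟪u, ∇p⟫ ≤ 0` (PRESSURE-DRIVEN),
  `⟪u, Du·v⟫ = 0` for all `v`, and `‖∇u(t, x)‖ ≤ C·L²` for ALL `x` and ALL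
  `t ∈ [τ_k + c₀/(c₂Y_k)², t₀]` (STRAIN-CAPPED). (⇐: an overshoot at `(t, x)` makes the level
  `L := min(‖u(t,x)‖, 2c₂Y_{k+1})` reached; its first overshoot is late by (i) since
  `L > c₂Y_{k+1} ≥ 2c₂Y_k` (`Schedule.Rigid.two_mul_ceiling_le`), and capped by (iii) applied on
  `[0, t]` with `M := L·max(1, ε/(4c₀))`, using `L²·c₀/(c₂Y_k)² ≥ 4c₀`; so `C` here is KNSS's constant
  times `max(1, ε/(4c₀))²`. ⇒: a first overshoot of `L > c₂Y_{k+1}` IS an overshoot.)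
* `palasekTowerBreakdown_aprioriCeiling_iff_noFirstOvershoot` (constant-free form: (ii) only) and
  `palasekTowerBreakdown_exists_aprioriCeiling_iff_noLateFirstOvershoot` ((i)+(ii)) — corollaries.
* BY NAME against the route decl: `palasekTowerBreakdown_heredityFromTwo_iff_noFirstOvershoot_and_floors`
  (`PalasekTowerBreakdown.HeredityFromTwo ↔ «no first overshoot» ∧ ReadoutFloors`, no hypothesis),
  `palasekTowerBreakdown_heredityFromTwo_of_noFirstOvershoot_floors` (the composition), and the capped
  door `palasekTowerBreakdown_exists_heredityFromTwo_of_noCappedFirstOvershoot_floors` (whoever proves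
  the upper stub may ASSUME lateness and the strain cap at the constants this theorem provides).

READING. The level may be taken as close to the ceiling as one likes (`L ≤ 2c₂Y_{k+1}` is a free
normalisation: every overshooting continuation first-overshoots levels just above `c₂Y_{k+1}`), so a
counterexample to the upper stub is EXACTLY: a registered stage at some `k ≥ 2` whose (unique) flow,
at a late silent time of window `k`, at a global speed maximum of speed `≤ 2c₂Y_{k+1}` with gradient
`≤ 4C(c₂Y_{k+1})²` everywhere, is pushed through the sphere `‖u‖ = L` by the pressure against the local
viscous rate. Nothing here says whether that happens.

References: S. Palasek, arXiv:2605.13827 §4 [cite: Palasek2026ElementaryModel, §4]; J. Leray, Acta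
Math. 63 (1934) §21 (3.15) [cite: Leray1934, §21 (3.15) p. 226]; G. Koch, N. Nadirashvili, G. Seregin,
V. Šverák, Acta Math. 203 (2009), Prop. 4.1 with (4.6)
[cite: KochNadirashviliSereginSverak2009, Prop. 4.1 with (4.6), k = 1 (arXiv:0709.3599v1 p. 8)].
-/

-- `Summit.<Summit>.<Problem>` is the tree's mandated summit-side namespace (CONVENTIONS §2); for this
-- single-conjunct summit the two coincide, so the duplicate is deliberate.
set_option linter.dupNamespace false

noncomputable section

namespace Summit.NavierStokesRegularity.NavierStokesRegularity.Theorems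

open Set MeasureTheory Filter Topology Function Real
open scoped ENNReal ContDiff NNReal InnerProductSpace RealInnerProductSpace
open Literature.Analysis.FluidPDE
open Summit.NavierStokesRegularity.NavierStokesRegularity.Theses
open Summit.NavierStokesRegularity.FluidComputer.PalasekTowerClayBridge

/-! ## §1 The upper stub as one late, strain-capped, pressure-driven first-overshoot event -/

/-- **`AprioriCeiling` ⟺ no LATE, STRAIN-CAPPED, pressure-driven FIRST OVERSHOOT** (universal
constants `c₀ > 0` — Leray's lifespan constant of the Kato window — and `C ≥ 0` — KNSS's gradient
constant times `max(1, ε/(4c₀))²`). For every pinned (`Λ = 8`, `θ = 6/5`) rigid quiet wide schedule,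
`k ≥ 2`, registered stage `s` at level `k` (unit viscosity), `T' ∈ [τ_k, τ_{k+1}]` and finite-energy
classical continuation `(u, p)` of `s` on `[0, T']`: no level `L ∈ (c₂Y_{k+1}, 2c₂Y_{k+1}]` is first
reached at a time `t₀ ∈ (τ_k, T']` with `τ_k + c₀/(c₂Y_k)² ≤ t₀`, at a global argmax `x₀`, with
`‖u‖ < L` on `[0, t₀) × ℝ³`, `0 ≤ ⟪u, ∂ₜu⟫`, `|Du|²_F + ⟪u, ∇p⟫ ≤ 0`, `⟪u, Du·v⟫ = 0` and
`‖∇u‖ ≤ C·L²` on `[τ_k + c₀/(c₂Y_k)², t₀] × ℝ³` — if and only if `AprioriCeiling`.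
[cite: Palasek2026ElementaryModel, §4] [cite: Leray1934, §21 (3.15) p. 226]
[cite: KochNadirashviliSereginSverak2009, Prop. 4.1 with (4.6), k = 1 (arXiv:0709.3599v1 p. 8)] -/
theorem palasekTowerBreakdown_exists_aprioriCeiling_iff_noCappedFirstOvershoot :
    ∃ c₀ : ℝ, 0 < c₀ ∧ ∃ C : ℝ, 0 ≤ C ∧
      (AprioriCeiling ↔
        ∀ S : Schedule TowerRates.wide, S.Pins 8 (6 / 5) → S.Rigid → S.Quiet → ∀ k : ℕ, 2 ≤ k →
        ∀ s : Stage 1 TowerRates.wide S (Margins.routeG TowerRates.wide) k,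
        ∀ T' ∈ Icc (S.τ k) (S.τ (k + 1)),
        ∀ (u : ℝ → EuclideanSpace ℝ (Fin 3) → EuclideanSpace ℝ (Fin 3))
          (p : ℝ → EuclideanSpace ℝ (Fin 3) → ℝ),
          IsClassicalNSSolutionOn (Icc 0 T') 1 S.f u p →
          (∀ t ∈ Icc 0 (S.τ k), u t = s.u t ∧ p t = s.p t) →
          (∃ E : ℝ≥0∞, E < ⊤ ∧ ∀ t ∈ Icc 0 T', ∫⁻ x, ‖u t x‖ₑ ^ 2 ≤ E) →
          ∀ L : ℝ, S.c₂ * TowerRates.wide.Y (k + 1) < L →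
            L ≤ 2 * (S.c₂ * TowerRates.wide.Y (k + 1)) →
          ∀ t₀ ∈ Ioc (S.τ k) T', S.τ k + c₀ / (S.c₂ * TowerRates.wide.Y k) ^ 2 ≤ t₀ →
          ∀ x₀ : EuclideanSpace ℝ (Fin 3), ‖u t₀ x₀‖ = L → (∀ x, ‖u t₀ x‖ ≤ L) →
            (∀ t ∈ Ico 0 t₀, ∀ x, ‖u t x‖ < L) →
            0 ≤ ⟪u t₀ x₀, timeDerivWithin (Icc 0 T') u t₀ x₀⟫ →
            frobeniusNormSq (fderiv ℝ (u t₀) x₀) + ⟪u t₀ x₀, gradient (p t₀) x₀⟫ ≤ 0 →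
            (∀ v, ⟪u t₀ x₀, fderiv ℝ (u t₀) x₀ v⟫ = 0) →
            (∀ t ∈ Icc (S.τ k + c₀ / (S.c₂ * TowerRates.wide.Y k) ^ 2) t₀, ∀ x,
              ‖fderiv ℝ (u t) x‖ ≤ C * L ^ 2) →
            False) := by
  obtain ⟨c₀, hc₀, hK⟩ := exists_norm_le_ceiling_of_kato_window
  obtain ⟨ε, hε, C, hC, hS⟩ := Stage.exists_strainCeiling_continuation
  set m : ℝ := max 1 (ε / (4 * c₀)) with hm
  have hm1 : 1 ≤ m := le_max_left _ _
  have hmε : ε / (4 * c₀) ≤ m := le_max_right _ _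
  refine ⟨c₀, hc₀, C * m ^ 2, by positivity, ?_, ?_⟩
  · -- (⇒): a first overshoot of a level above the ceiling IS an overshoot
    intro hA S hP hR hQ k hk s T' hT' u p hcl hagree hE L hBL _ t₀ ht₀ _ x₀ heq _ _ _ _ _ _
    have ht₀' : t₀ ∈ Icc 0 T' := ⟨((S.τ_pos k).trans ht₀.1).le, ht₀.2⟩
    have := hA S hP hR hQ k hk s T' hT' u p hcl hagree hE t₀ ht₀' x₀
    linarith
  · -- (⇐): an overshoot produces a late, capped, pressure-driven first overshoot
    intro h S hP hR hQ k hk s T' hT' u p hcl hagree hE t ht x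
    by_contra hgt
    have hgt' : S.c₂ * TowerRates.wide.Y (k + 1) < ‖u t x‖ := lt_of_not_ge hgt
    have hc₂ : 0 < S.c₂ := s.c₂_pos
    have hYk : 0 < TowerRates.wide.Y k := Real.rpow_pos_of_pos (TowerRates.wide.N_pos k) _
    have hA : 0 < S.c₂ * TowerRates.wide.Y k := mul_pos hc₂ hYk
    have hAB : S.c₂ * TowerRates.wide.Y k < S.c₂ * TowerRates.wide.Y (k + 1) :=
      mul_lt_mul_of_pos_left (TowerRates.wide.Y_lt_Y_succ k) hc₂
    have hB : 0 < S.c₂ * TowerRates.wide.Y (k + 1) := hA.trans hAB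
    have h2AB : 2 * (S.c₂ * TowerRates.wide.Y k) ≤ S.c₂ * TowerRates.wide.Y (k + 1) :=
      hR.two_mul_ceiling_le k
    -- the level: as close to the ceiling as the overshoot allows, and at most twice the ceiling
    set L : ℝ := min ‖u t x‖ (2 * (S.c₂ * TowerRates.wide.Y (k + 1))) with hLdef
    have hBL : S.c₂ * TowerRates.wide.Y (k + 1) < L := lt_min hgt' (by linarith)
    have hL2 : L ≤ 2 * (S.c₂ * TowerRates.wide.Y (k + 1)) := min_le_right _ _
    have hL0 : 0 < L := hB.trans hBL
    have hAL : S.c₂ * TowerRates.wide.Y k < L := hAB.trans hBL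
    have hL2A : 2 * (S.c₂ * TowerRates.wide.Y k) ≤ L := h2AB.trans hBL.le
    have hk1 : 1 ≤ k := le_trans one_le_two hk
    obtain ⟨t₀, ht₀, x₀, heq, hle, hstrict, htime, hineq⟩ :=
      s.exists_firstOvershoot one_pos hQ hk1 hT'.1 hcl (fun r hr => (hagree r hr).1) hE hAL
        ⟨t, ht, x, min_le_left _ _⟩
    rw [one_mul] at hineq
    have ht₀' : t₀ ∈ Icc 0 T' := ⟨((S.τ_pos k).trans ht₀.1).le, ht₀.2⟩
    -- (i) lateness: the Kato/Leray start of the window is overshoot-free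
    have hlate : S.τ k + c₀ / (S.c₂ * TowerRates.wide.Y k) ^ 2 ≤ t₀ := by
      by_contra hlt
      have hlt' : t₀ - S.τ k < c₀ / (S.c₂ * TowerRates.wide.Y k) ^ 2 := by
        linarith [lt_of_not_ge hlt]
      have := hK S hP hR hQ k hk1 s T' hT' u p hcl hagree hE t₀ ht₀' hlt' x₀
      linarith
    -- (ii) first-order condition at the global argmax
    have hmax : ∀ y, ‖u t₀ y‖ ≤ ‖u t₀ x₀‖ := fun y => by rw [heq]; exact hle y
    have hfo : ∀ v, ⟪u t₀ x₀, fderiv ℝ (u t₀) x₀ v⟫ = 0 :=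
      fun v => HittingCalculus.inner_fderiv_eq_zero_of_isMax hcl ht₀' hmax v
    -- (iii) the strain cap on the late part of the window up to the first overshoot
    have hδ : 0 < c₀ / (S.c₂ * TowerRates.wide.Y k) ^ 2 := div_pos hc₀ (pow_pos hA 2)
    have hcap : ∀ t' ∈ Icc (S.τ k + c₀ / (S.c₂ * TowerRates.wide.Y k) ^ 2) t₀, ∀ y,
        ‖fderiv ℝ (u t') y‖ ≤ C * m ^ 2 * L ^ 2 := by
      intro t' ht' y
      have hτt' : S.τ k < t' := by linarith [ht'.1]
      have ht'T : t' ≤ T' := ht'.2.trans ht₀.2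
      have ht'0 : 0 < t' := (S.τ_pos k).trans hτt'
      -- restrict the continuation to the slab `[0, t']`
      have hcl' : IsClassicalNSSolutionOn (Icc 0 t') 1 S.f u p :=
        hcl.mono (Icc_subset_Icc_right ht'T) (uniqueDiffOn_Icc ht'0)
      have hE' : ∃ E : ℝ≥0∞, E < ⊤ ∧ ∀ r ∈ Icc 0 t', ∫⁻ z, ‖u r z‖ₑ ^ 2 ≤ E := by
        obtain ⟨E, hEt, hEb⟩ := hE
        exact ⟨E, hEt, fun r hr => hEb r ⟨hr.1, hr.2.trans ht'T⟩⟩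
      -- before the first overshoot the speed is `≤ L ≤ L·m`
      have hbound : ∀ r ∈ Icc (S.τ k) t', ∀ z, ‖u r z‖ ≤ L * m := by
        intro r hr z
        have hrL : ‖u r z‖ ≤ L := by
          rcases lt_or_ge r t₀ with hlt | hge
          · exact (hstrict r ⟨(S.τ_pos k).le.trans hr.1, hlt⟩ z).le
          · have hr0 : r = t₀ := le_antisymm (hr.2.trans ht'.2) hge
            rw [hr0]
            exact hle z
        calc ‖u r z‖ ≤ L := hrL
          _ = L * 1 := (mul_one L).symm
          _ ≤ L * m := mul_le_mul_of_nonneg_left hm1 hL0.le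
      -- the smoothing time is available: `(L·m)²·(t' − τ_k) ≥ 4c₀·m² ≥ 4c₀·m ≥ ε`
      have hεt : ε ≤ (L * m) ^ 2 * (t' - S.τ k) := by
        have h1 : c₀ / (S.c₂ * TowerRates.wide.Y k) ^ 2 ≤ t' - S.τ k := by linarith [ht'.1]
        have h1' : c₀ ≤ (t' - S.τ k) * (S.c₂ * TowerRates.wide.Y k) ^ 2 :=
          (div_le_iff₀ (pow_pos hA 2)).1 h1
        have hdt : 0 ≤ t' - S.τ k := by linarith
        have h4 : 4 * (S.c₂ * TowerRates.wide.Y k) ^ 2 ≤ L ^ 2 := by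
          have h := mul_le_mul hL2A hL2A (by positivity) hL0.le
          nlinarith [h]
        have h5a : 4 * (S.c₂ * TowerRates.wide.Y k) ^ 2 * (t' - S.τ k) ≤ L ^ 2 * (t' - S.τ k) :=
          mul_le_mul_of_nonneg_right h4 hdt
        have h5 : 4 * c₀ ≤ L ^ 2 * (t' - S.τ k) := by linarith [h1', h5a]
        have h6 : ε ≤ 4 * c₀ * m := by
          have := (div_le_iff₀ (by positivity : (0 : ℝ) < 4 * c₀)).1 hmε
          linarith
        have h7 : m ≤ m ^ 2 := by nlinarith [hm1]
        calc ε ≤ 4 * c₀ * m := h6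
          _ ≤ 4 * c₀ * m ^ 2 := mul_le_mul_of_nonneg_left h7 (by positivity)
          _ ≤ L ^ 2 * (t' - S.τ k) * m ^ 2 := mul_le_mul_of_nonneg_right h5 (sq_nonneg m)
          _ = (L * m) ^ 2 * (t' - S.τ k) := by ring
      have key := hS hQ hk1 s hτt' hcl' (fun r hr => (hagree r hr).1) hE' hbound t'
        ⟨hτt'.le, le_rfl⟩ hεt y
      calc ‖fderiv ℝ (u t') y‖ ≤ C * (L * m) ^ 2 := key
        _ = C * m ^ 2 * L ^ 2 := by ring
    exact h S hP hR hQ k hk s T' hT' u p hcl hagree hE L hBL hL2 t₀ ht₀ hlate x₀ heq hle hstrict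
      htime hineq hfo hcap

/-! ## §2 Corollaries: the constant-free event and the late event -/

/-- **`AprioriCeiling` ⟺ no pressure-driven FIRST OVERSHOOT of a level in `(c₂Y_{k+1}, 2c₂Y_{k+1}]`**
(constant-free form). [cite: Palasek2026ElementaryModel, §4] -/
theorem palasekTowerBreakdown_aprioriCeiling_iff_noFirstOvershoot :
    AprioriCeiling ↔
      ∀ S : Schedule TowerRates.wide, S.Pins 8 (6 / 5) → S.Rigid → S.Quiet → ∀ k : ℕ, 2 ≤ k →
      ∀ s : Stage 1 TowerRates.wide S (Margins.routeG TowerRates.wide) k,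
      ∀ T' ∈ Icc (S.τ k) (S.τ (k + 1)),
      ∀ (u : ℝ → EuclideanSpace ℝ (Fin 3) → EuclideanSpace ℝ (Fin 3))
        (p : ℝ → EuclideanSpace ℝ (Fin 3) → ℝ),
        IsClassicalNSSolutionOn (Icc 0 T') 1 S.f u p →
        (∀ t ∈ Icc 0 (S.τ k), u t = s.u t ∧ p t = s.p t) →
        (∃ E : ℝ≥0∞, E < ⊤ ∧ ∀ t ∈ Icc 0 T', ∫⁻ x, ‖u t x‖ₑ ^ 2 ≤ E) →
        ∀ L : ℝ, S.c₂ * TowerRates.wide.Y (k + 1) < L →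
          L ≤ 2 * (S.c₂ * TowerRates.wide.Y (k + 1)) →
        ∀ t₀ ∈ Ioc (S.τ k) T', ∀ x₀ : EuclideanSpace ℝ (Fin 3),
          ‖u t₀ x₀‖ = L → (∀ x, ‖u t₀ x‖ ≤ L) → (∀ t ∈ Ico 0 t₀, ∀ x, ‖u t x‖ < L) →
          0 ≤ ⟪u t₀ x₀, timeDerivWithin (Icc 0 T') u t₀ x₀⟫ →
          frobeniusNormSq (fderiv ℝ (u t₀) x₀) + ⟪u t₀ x₀, gradient (p t₀) x₀⟫ ≤ 0 →
          (∀ v, ⟪u t₀ x₀, fderiv ℝ (u t₀) x₀ v⟫ = 0) → False := by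
  obtain ⟨c₀, -, C, -, hiff⟩ := palasekTowerBreakdown_exists_aprioriCeiling_iff_noCappedFirstOvershoot
  refine ⟨fun hA => ?_, fun h => hiff.2 ?_⟩
  · intro S hP hR hQ k hk s T' hT' u p hcl hagree hE L hBL _ t₀ ht₀ x₀ heq _ _ _ _ _
    have ht₀' : t₀ ∈ Icc 0 T' := ⟨((S.τ_pos k).trans ht₀.1).le, ht₀.2⟩
    have := hA S hP hR hQ k hk s T' hT' u p hcl hagree hE t₀ ht₀' x₀
    linarith
  · intro S hP hR hQ k hk s T' hT' u p hcl hagree hE L hBL hL2 t₀ ht₀ _ x₀ heq hle hstrict htime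
      hineq hfo _
    exact h S hP hR hQ k hk s T' hT' u p hcl hagree hE L hBL hL2 t₀ ht₀ x₀ heq hle hstrict htime
      hineq hfo

/-- **`AprioriCeiling` ⟺ no LATE pressure-driven first overshoot** (the Kato/Leray start
`[τ_k, τ_k + c₀/(c₂Y_k)²)` of each window is excluded by theorem).
[cite: Leray1934, §21 (3.15) p. 226] -/
theorem palasekTowerBreakdown_exists_aprioriCeiling_iff_noLateFirstOvershoot :
    ∃ c₀ : ℝ, 0 < c₀ ∧
      (AprioriCeiling ↔
        ∀ S : Schedule TowerRates.wide, S.Pins 8 (6 / 5) → S.Rigid → S.Quiet → ∀ k : ℕ, 2 ≤ k →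
        ∀ s : Stage 1 TowerRates.wide S (Margins.routeG TowerRates.wide) k,
        ∀ T' ∈ Icc (S.τ k) (S.τ (k + 1)),
        ∀ (u : ℝ → EuclideanSpace ℝ (Fin 3) → EuclideanSpace ℝ (Fin 3))
          (p : ℝ → EuclideanSpace ℝ (Fin 3) → ℝ),
          IsClassicalNSSolutionOn (Icc 0 T') 1 S.f u p →
          (∀ t ∈ Icc 0 (S.τ k), u t = s.u t ∧ p t = s.p t) →
          (∃ E : ℝ≥0∞, E < ⊤ ∧ ∀ t ∈ Icc 0 T', ∫⁻ x, ‖u t x‖ₑ ^ 2 ≤ E) →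
          ∀ L : ℝ, S.c₂ * TowerRates.wide.Y (k + 1) < L →
            L ≤ 2 * (S.c₂ * TowerRates.wide.Y (k + 1)) →
          ∀ t₀ ∈ Ioc (S.τ k) T', S.τ k + c₀ / (S.c₂ * TowerRates.wide.Y k) ^ 2 ≤ t₀ →
          ∀ x₀ : EuclideanSpace ℝ (Fin 3), ‖u t₀ x₀‖ = L → (∀ x, ‖u t₀ x‖ ≤ L) →
            (∀ t ∈ Ico 0 t₀, ∀ x, ‖u t x‖ < L) →
            0 ≤ ⟪u t₀ x₀, timeDerivWithin (Icc 0 T') u t₀ x₀⟫ →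
            frobeniusNormSq (fderiv ℝ (u t₀) x₀) + ⟪u t₀ x₀, gradient (p t₀) x₀⟫ ≤ 0 →
            (∀ v, ⟪u t₀ x₀, fderiv ℝ (u t₀) x₀ v⟫ = 0) → False) := by
  obtain ⟨c₀, hc₀, C, -, hiff⟩ :=
    palasekTowerBreakdown_exists_aprioriCeiling_iff_noCappedFirstOvershoot
  refine ⟨c₀, hc₀, fun hA => ?_, fun h => hiff.2 ?_⟩
  · intro S hP hR hQ k hk s T' hT' u p hcl hagree hE L hBL _ t₀ ht₀ _ x₀ heq _ _ _ _ _
    have ht₀' : t₀ ∈ Icc 0 T' := ⟨((S.τ_pos k).trans ht₀.1).le, ht₀.2⟩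
    have := hA S hP hR hQ k hk s T' hT' u p hcl hagree hE t₀ ht₀' x₀
    linarith
  · intro S hP hR hQ k hk s T' hT' u p hcl hagree hE L hBL hL2 t₀ ht₀ hlate x₀ heq hle hstrict htime
      hineq hfo _
    exact h S hP hR hQ k hk s T' hT' u p hcl hagree hE L hBL hL2 t₀ ht₀ hlate x₀ heq hle hstrict
      htime hineq hfo

/-! ## §3 By name against the route decl `PalasekTowerBreakdown.HeredityFromTwo` -/

/-- **The child crux re-typed through the event (no hypothesis)**:
`PalasekTowerBreakdown.HeredityFromTwo ↔ «no pressure-driven first overshoot of a level in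
(c₂Y_{k+1}, 2c₂Y_{k+1}] by a finite-energy classical continuation of a registered stage at k ≥ 2» ∧
ReadoutFloors` (`heredityFrom_two_iff_aprioriCeiling_and_floors` + §2). [folklore] -/
theorem palasekTowerBreakdown_heredityFromTwo_iff_noFirstOvershoot_and_floors :
    PalasekTowerBreakdown.HeredityFromTwo ↔
      (∀ S : Schedule TowerRates.wide, S.Pins 8 (6 / 5) → S.Rigid → S.Quiet → ∀ k : ℕ, 2 ≤ k →
      ∀ s : Stage 1 TowerRates.wide S (Margins.routeG TowerRates.wide) k,
      ∀ T' ∈ Icc (S.τ k) (S.τ (k + 1)),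
      ∀ (u : ℝ → EuclideanSpace ℝ (Fin 3) → EuclideanSpace ℝ (Fin 3))
        (p : ℝ → EuclideanSpace ℝ (Fin 3) → ℝ),
        IsClassicalNSSolutionOn (Icc 0 T') 1 S.f u p →
        (∀ t ∈ Icc 0 (S.τ k), u t = s.u t ∧ p t = s.p t) →
        (∃ E : ℝ≥0∞, E < ⊤ ∧ ∀ t ∈ Icc 0 T', ∫⁻ x, ‖u t x‖ₑ ^ 2 ≤ E) →
        ∀ L : ℝ, S.c₂ * TowerRates.wide.Y (k + 1) < L →
          L ≤ 2 * (S.c₂ * TowerRates.wide.Y (k + 1)) →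
        ∀ t₀ ∈ Ioc (S.τ k) T', ∀ x₀ : EuclideanSpace ℝ (Fin 3),
          ‖u t₀ x₀‖ = L → (∀ x, ‖u t₀ x‖ ≤ L) → (∀ t ∈ Ico 0 t₀, ∀ x, ‖u t x‖ < L) →
          0 ≤ ⟪u t₀ x₀, timeDerivWithin (Icc 0 T') u t₀ x₀⟫ →
          frobeniusNormSq (fderiv ℝ (u t₀) x₀) + ⟪u t₀ x₀, gradient (p t₀) x₀⟫ ≤ 0 →
          (∀ v, ⟪u t₀ x₀, fderiv ℝ (u t₀) x₀ v⟫ = 0) → False) ∧ ReadoutFloors :=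
  heredityFrom_two_iff_aprioriCeiling_and_floors.trans
    (and_congr_left' palasekTowerBreakdown_aprioriCeiling_iff_noFirstOvershoot)

/-- **The composition concluding the child crux BY NAME** from the event form of the upper stub and
the registered lower stub `ReadoutFloors`. [folklore] -/
theorem palasekTowerBreakdown_heredityFromTwo_of_noFirstOvershoot_floors
    (hA : ∀ S : Schedule TowerRates.wide, S.Pins 8 (6 / 5) → S.Rigid → S.Quiet → ∀ k : ℕ, 2 ≤ k →
      ∀ s : Stage 1 TowerRates.wide S (Margins.routeG TowerRates.wide) k,
      ∀ T' ∈ Icc (S.τ k) (S.τ (k + 1)),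
      ∀ (u : ℝ → EuclideanSpace ℝ (Fin 3) → EuclideanSpace ℝ (Fin 3))
        (p : ℝ → EuclideanSpace ℝ (Fin 3) → ℝ),
        IsClassicalNSSolutionOn (Icc 0 T') 1 S.f u p →
        (∀ t ∈ Icc 0 (S.τ k), u t = s.u t ∧ p t = s.p t) →
        (∃ E : ℝ≥0∞, E < ⊤ ∧ ∀ t ∈ Icc 0 T', ∫⁻ x, ‖u t x‖ₑ ^ 2 ≤ E) →
        ∀ L : ℝ, S.c₂ * TowerRates.wide.Y (k + 1) < L →
          L ≤ 2 * (S.c₂ * TowerRates.wide.Y (k + 1)) →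
        ∀ t₀ ∈ Ioc (S.τ k) T', ∀ x₀ : EuclideanSpace ℝ (Fin 3),
          ‖u t₀ x₀‖ = L → (∀ x, ‖u t₀ x‖ ≤ L) → (∀ t ∈ Ico 0 t₀, ∀ x, ‖u t x‖ < L) →
          0 ≤ ⟪u t₀ x₀, timeDerivWithin (Icc 0 T') u t₀ x₀⟫ →
          frobeniusNormSq (fderiv ℝ (u t₀) x₀) + ⟪u t₀ x₀, gradient (p t₀) x₀⟫ ≤ 0 →
          (∀ v, ⟪u t₀ x₀, fderiv ℝ (u t₀) x₀ v⟫ = 0) → False)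
    (hB : ReadoutFloors) : PalasekTowerBreakdown.HeredityFromTwo :=
  palasekTowerBreakdown_heredityFromTwo_iff_noFirstOvershoot_and_floors.2 ⟨hA, hB⟩

/-- **The capped door to the child crux**: there are universal `c₀ > 0`, `C ≥ 0` such that excluding
LATE (`t₀ ≥ τ_k + c₀/(c₂Y_k)²`), STRAIN-CAPPED (`‖∇u‖ ≤ C·L²` on `[τ_k + c₀/(c₂Y_k)², t₀] × ℝ³`),
pressure-driven first overshoots of levels `L ∈ (c₂Y_{k+1}, 2c₂Y_{k+1}]`, together with
`ReadoutFloors`, proves `PalasekTowerBreakdown.HeredityFromTwo` — whoever proves the upper stub may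
ASSUME lateness and the strain cap. [cite: Leray1934, §21 (3.15) p. 226]
[cite: KochNadirashviliSereginSverak2009, Prop. 4.1 with (4.6), k = 1 (arXiv:0709.3599v1 p. 8)] -/
theorem palasekTowerBreakdown_exists_heredityFromTwo_of_noCappedFirstOvershoot_floors :
    ∃ c₀ : ℝ, 0 < c₀ ∧ ∃ C : ℝ, 0 ≤ C ∧
      ((∀ S : Schedule TowerRates.wide, S.Pins 8 (6 / 5) → S.Rigid → S.Quiet → ∀ k : ℕ, 2 ≤ k →
        ∀ s : Stage 1 TowerRates.wide S (Margins.routeG TowerRates.wide) k,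
        ∀ T' ∈ Icc (S.τ k) (S.τ (k + 1)),
        ∀ (u : ℝ → EuclideanSpace ℝ (Fin 3) → EuclideanSpace ℝ (Fin 3))
          (p : ℝ → EuclideanSpace ℝ (Fin 3) → ℝ),
          IsClassicalNSSolutionOn (Icc 0 T') 1 S.f u p →
          (∀ t ∈ Icc 0 (S.τ k), u t = s.u t ∧ p t = s.p t) →
          (∃ E : ℝ≥0∞, E < ⊤ ∧ ∀ t ∈ Icc 0 T', ∫⁻ x, ‖u t x‖ₑ ^ 2 ≤ E) →
          ∀ L : ℝ, S.c₂ * TowerRates.wide.Y (k + 1) < L →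
            L ≤ 2 * (S.c₂ * TowerRates.wide.Y (k + 1)) →
          ∀ t₀ ∈ Ioc (S.τ k) T', S.τ k + c₀ / (S.c₂ * TowerRates.wide.Y k) ^ 2 ≤ t₀ →
          ∀ x₀ : EuclideanSpace ℝ (Fin 3), ‖u t₀ x₀‖ = L → (∀ x, ‖u t₀ x‖ ≤ L) →
            (∀ t ∈ Ico 0 t₀, ∀ x, ‖u t x‖ < L) →
            0 ≤ ⟪u t₀ x₀, timeDerivWithin (Icc 0 T') u t₀ x₀⟫ →
            frobeniusNormSq (fderiv ℝ (u t₀) x₀) + ⟪u t₀ x₀, gradient (p t₀) x₀⟫ ≤ 0 →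
            (∀ v, ⟪u t₀ x₀, fderiv ℝ (u t₀) x₀ v⟫ = 0) →
            (∀ t ∈ Icc (S.τ k + c₀ / (S.c₂ * TowerRates.wide.Y k) ^ 2) t₀, ∀ x,
              ‖fderiv ℝ (u t) x‖ ≤ C * L ^ 2) →
            False) →
        ReadoutFloors → PalasekTowerBreakdown.HeredityFromTwo) := by
  obtain ⟨c₀, hc₀, C, hC, hiff⟩ :=
    palasekTowerBreakdown_exists_aprioriCeiling_iff_noCappedFirstOvershoot
  exact ⟨c₀, hc₀, C, hC, fun hA hB => heredityFrom_two_of_aprioriCeiling_floors (hiff.2 hA) hB⟩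

end Summit.NavierStokesRegularity.NavierStokesRegularity.Theorems

end
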